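import Summits.Ventures.Crystal3D.Theorems.StickyWulffConstantPolycrystalWulffBoundRungGapTreeLaw
import Summits.Ventures.Crystal3D.Theorems.StickyWulffConstantPolycrystalWulffBoundGenericShiftThirteenTwentyFifths

/-!
# `PolycrystalWulffBound`, line `PolyDensity`: `rung_gapTree_law_thirteenTwentyFifths` — the by-wall-type
# tree rung with GENERIC edges paid `13/25` (crux `stmt-Ventures-19482`; cf-p1 DECISION (lxiv)
# «13/25 insurance rung», thread L-2 of §87.0)

Route `StickyWulffConstant` of the venture `Summits/Ventures/Crystal3D`, second prover lane (poly-p2,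
gen 16).  Verbatim `rung_gapTree_law_threeFifths` (gen 15) with the generic alternative `θ i = 3/5`
replaced by `θ i = 13/25`, discharged by the four-shell generic shift lemma
`cruxWulffBody_cap_shift_thirteen_twentyfifths` (`…GenericShiftThirteenTwentyFifths`): every sorted TREE of
polyhedral grains with arbitrary lattices satisfies `6·2^{1/3}(√2·Vol)^{2/3} ≤ Fr + Σ_i θ i·S i` with
per-edge gaps `θ i ∈ {0 (same lattice), (1/√6)·√(1 − ⟪m i, m'⟫²) (co-axial about m'), 13/25 (generic)}` —
i.e. the forest class of the P map is uniform under ANY wall law `(c₀, c₁)` with `c₀ ≥ 13/25 = 0.52`,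
`c₁ ≥ 1/√6`.  This is the P-side certificate g30 needs if it picks `c₀ = 13/25` by the rule «largest
P-certified θ with G-inf − θ ≥ 0.03»; the law of record is not restated here.
WHAT THIS IS NOT: the `En` form; a decision on the law constant; the crux is not claimed.
-/

noncomputable section

open scoped BigOperators InnerProductSpace ENNReal Pointwise
open MeasureTheory Filter Set

namespace Summit.Ventures.Crystal3D.Cruxes.PolycrystalWulffBound.PolyDensity

open Summit.Ventures.Crystal3D.Theorems
open Summit.Ventures.Crystal3D.Cruxes.TextureLiminf.TexShadow (per polytope E3)
open Literature.MathematicalPhysics.StatisticalMechanics (fccStacking barlowStacking IsHaggSeq perimeter)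

/-- **Rung `rung_gapTree_law_thirteenTwentyFifths`**: `rung_gapTree` with the shifts supplied by wall type
(same lattice `0`, co-axial `(1/√6)·√(1 − ⟪m i, m'⟫²)`, generic `13/25`). -/
theorem rung_gapTree_law_thirteenTwentyFifths : let Λ : Set (EuclideanSpace ℝ (Fin 3)) := Literature.MathematicalPhysics.StatisticalMechanics.fccStacking 1 (Real.sqrt (2 / 3)); let Brl : (ℤ → ℤ) → Set (EuclideanSpace ℝ (Fin 3)) := Literature.MathematicalPhysics.StatisticalMechanics.barlowStacking 1 (Real.sqrt (2 / 3)); let Ax : EuclideanSpace ℝ (Fin 3) → (EuclideanSpace ℝ (Fin 3) ≃ₗᵢ[ℝ] EuclideanSpace ℝ (Fin 3)) → (EuclideanSpace ℝ (Fin 3) ≃ₗᵢ[ℝ] EuclideanSpace ℝ (Fin 3)) → Prop := fun m A B => ∃ (L : EuclideanSpace ℝ (Fin 3) ≃ₗᵢ[ℝ] EuclideanSpace ℝ (Fin 3)) (s₁ s₂ : EuclideanSpace ℝ (Fin 3)) (σ σ' : ℤ → ℤ), Literature.MathematicalPhysics.StatisticalMechanics.IsHaggSeq σ ∧ Literature.MathematicalPhysics.StatisticalMechanics.IsHaggSeq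 σ' ∧ L (EuclideanSpace.single (2 : Fin 3) (1 : ℝ)) = m ∧ A '' Λ ⊆ (fun q => L q + s₁) '' Brl σ ∧ B '' Λ ⊆ (fun q => L q + s₂) '' Brl σ'; let Φ : EuclideanSpace ℝ (Fin 3) → ℝ := fun ν => Real.sqrt 2 / 4 * ∑ᶠ w ∈ {w ∈ Λ | ‖w‖ = 1}, |⟪w, ν⟫_ℝ|; let Per : Set (EuclideanSpace ℝ (Fin 3)) → Set (EuclideanSpace ℝ (Fin 3)) → ℝ := fun K S => (⨆ (ξ : EuclideanSpace ℝ (Fin 3) → EuclideanSpace ℝ (Fin 3)) (_ : ContDiff ℝ 1 ξ ∧ HasCompactSupport ξ ∧ ∀ z, ξ z ∈ K), ENNReal.ofReal (∫ z in S, Literature.MathematicalPhysics.StatisticalMechanics.fieldDivergence ξ z)).toReal; let ι : Set (EuclideanSpace ℝ (Fin 3)) → Set (EuclideanSpace ℝ (Fin 3)) → Set (EuclideanSpace ℝ (Fin 3)) → ℝ := fun K S₁ S₂ => (Per K S₁ + Per K S₂ - Per K (S₁ ∪ S₂)) / 2; let W : (EuclideanSpace ℝ (Fin 3) ≃ₗᵢ[ℝ]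 EuclideanSpace ℝ (Fin 3)) → Set (EuclideanSpace ℝ (Fin 3)) := fun A => {y | ∀ ν : EuclideanSpace ℝ (Fin 3), ⟪y, ν⟫_ℝ ≤ Φ (A.symm ν)}; let Vol : (n : ℕ) → (Fin n → Set (EuclideanSpace ℝ (Fin 3))) → ℝ := fun n G => (volume (⋃ f : Fin n, G f)).toReal; let Poly : Set (EuclideanSpace ℝ (Fin 3)) → Prop := fun S => ∃ (k : ℕ) (H : Fin k → Finset ((EuclideanSpace ℝ (Fin 3)) × ℝ)), S = ⋃ i, ⋂ p ∈ H i, {x | ⟪p.1, x⟫_ℝ < p.2}; let Fr : (n : ℕ) → (Fin n → Set (EuclideanSpace ℝ (Fin 3))) → (Fin n → (EuclideanSpace ℝ (Fin 3) ≃ₗᵢ[ℝ] EuclideanSpace ℝ (Fin 3))) → ℝ := fun n G A => ∑ f : Fin n, Per (W (A f)) (G f) - ∑ f, ∑ g, (if f = g then 0 else ι (W (A f)) (G f) (G g)); ∀ (N : ℕ) (par : Fin N → Fin (N + 1)), (∀ i, (par i : ℕ) ≤ i) → ∀ (m : Fin N → EuclideanSpace ℝ (Fin 3)) (t θ S : Fin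 N → ℝ) (G : Fin (N + 1) → Set (EuclideanSpace ℝ (Fin 3))) (A : Fin (N + 1) → (EuclideanSpace ℝ (Fin 3) ≃ₗᵢ[ℝ] EuclideanSpace ℝ (Fin 3))), (∀ f, Poly (G f)) → (∀ f, volume (G f) < ⊤) → (∀ i, ‖m i‖ = 1) → (∀ i, (A (par i) '' Λ = A i.succ '' Λ ∧ θ i = 0) ∨ (∃ m' : EuclideanSpace ℝ (Fin 3), Ax m' (A (par i)) (A i.succ) ∧ θ i = 1 / Real.sqrt 6 * Real.sqrt (1 - ⟪m i, m'⟫_ℝ ^ 2)) ∨ θ i = 13 / 25) → (∀ i, 0 ≤ S i) → (∀ i (h : ℝ), 0 < h → volume (G i.succ ∩ {x | ⟪x, m i⟫_ℝ < t i + h}) ≤ ENNReal.ofReal (h * S i)) → (∀ i, ∀ x ∈ G i.succ, t i < ⟪x, m i⟫_ℝ) → ∀ (δ : ℝ), 0 < δ → (∀ i, ∀ x ∈ G (par i), ⟪x, m i⟫_ℝ < t i ∨ ∀ y ∈ G i.succ, δ ≤ dist x y) → (∀ f g : Fin (N + 1), f ≠ g → (∀ i, ¬ (f = par i ∧ g =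 i.succ)) → (∀ i, ¬ (g = par i ∧ f = i.succ)) → ∀ x ∈ G f, ∀ y ∈ G g, δ ≤ dist x y) → 6 * (2 : ℝ) ^ ((1 : ℝ) / 3) * (Real.sqrt 2 * Vol (N + 1) G) ^ ((2 : ℝ) / 3) ≤ Fr (N + 1) G A + ∑ i, θ i * S i := by
  intro Λ Brl Ax Φ Per ι W Vol Poly Fr N par hpar m t θ S G A hGpoly hGv hm1 hkind hS0 hS hGt δ hδ hPt hsep
  have hθ : ∀ i, 0 ≤ θ i := by
    intro i
    rcases hkind i with ⟨-, h⟩ | ⟨m', -, h⟩ | h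
    · rw [h]
    · rw [h]; positivity
    · rw [h]; norm_num
  have hshift : ∀ i (s : ℝ), volume (W (A (par i)) ∩ {y | s + θ i < ⟪y, m i⟫_ℝ}) ≤
      volume (W (A i.succ) ∩ {y | s < ⟪y, m i⟫_ℝ}) := by
    intro i s
    rcases hkind i with ⟨hΛ, h⟩ | ⟨m', hAx, h⟩ | h
    · rw [h]; exact capShift_zero_of_image_eq hΛ s
    · rw [h]; exact capShift_of_coaxial hAx (hm1 i) s
    · rw [h]; exact cruxWulffBody_cap_shift_thirteen_twentyfifths (A (par i)) (A i.succ) (hm1 i) s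
  exact rung_gapTree N par hpar m t θ S G A hGpoly hGv hm1 hθ hshift hS0 hS hGt δ hδ hPt hsep

end Summit.Ventures.Crystal3D.Cruxes.PolycrystalWulffBound.PolyDensity

end
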